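import Mathlib
import Summits.NavierStokesRegularity.NavierStokesRegularity.Theorems.EulerZoomLiouvillePowerGaugeEulerLiouvilleSelfSimilarPastProfileEquations
import Summits.NavierStokesRegularity.NavierStokesRegularity.Theorems.EulerZoomLiouvillePowerGaugeEulerLiouvilleWeakPressureGradientTools
import Summits.NavierStokesRegularity.NavierStokesRegularity.Theorems.EulerZoomLiouvillePowerGaugeEulerLiouvilleWeakVorticityLamb
import HarnessLib

/-!
# Crux `EulerZoomLiouville.PowerGaugeEulerLiouville` (stmt-NavierStokesRegularity-19832), weak stratum, lines `weak_eulerian` (E1) /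
# `weak_axisym` (X0): THE WEAK VORTICITY EQUATION — `stub_weakVorticityEquation` filled

Route №10 `EulerZoomLiouville` (NavierStokesRegularity), crux E = stmt-NavierStokesRegularity-19832; width seat ns-ezl-w1 g9 under the LEAD ns-typeII-p2.
A weak exactly self-similar class member (any `ρ ∈ (0,½]`, `γ = 1/(2+ρ)`) with DiPerna–Lions data `G` (weak gradient of the profile `V`,
`G ∈ L²_loc`, `V ∈ L⁶_loc`) solves the WEAK VORTICITY EQUATION `div(W ⊗ Ω) = (3γ − 1)Ω + GΩ` in `𝒟′(ℝ³)`, `Ω = curlCLM ∘ G`, `W = γy + V`: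
`∫ ⟪Ω, e⟫ Dψ[W] = ∫ ψ ⟪(1 − 3γ)Ω − GΩ, e⟫` for every scalar test `ψ` and every `e`.

* `weakVorticityEquation` — **`Sig.stub_weakVorticityEquation` of `Lines/weak_eulerian.lean` (E1) = `Lines/weak_axisym.lean` (X0) δ-unfolded**
  (fill: `intro ρ hρ hρh u p H c V P G hcl hss hG hdiv; exact WeakEulerian.weakVorticityEquation hρ hρh hcl hss hG hdiv`).
  PROOF: the weak profile equation of the member (`Past.profileData_of_past`, clause (M)) tested with the curl field `Ψ = curl(ψ•e)`
  (`div Ψ = 0` kills the pressure); `∫⟪V,Ψ⟫ = ∫ψ⟪Ω,e⟫` and `∫⟪V, DΨ x x⟫ = ∫(Dψ[x] − ψ)⟪Ω,e⟫` (weak curl transfer, `D(curl ψe)(x)[x] = curl((Dψ[x]−ψ)e)`);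
  `∫⟪V, DΨ V⟫ = −∫⟪GV, Ψ⟫` (tree N1 `WeakPressure.integral_inner_fderiv_apply_self`), and by the Lamb–Lagrange identity
  `⟪GV,Ψ⟫ = ⟪GΨ,V⟫ + Dψ[Ω]⟪V,e⟫ − ⟪Ω,e⟫Dψ[V]` with `∫⟪GΨ,V⟫ = 0` (gradient of `½‖V‖²`) and `∫Dψ[Ω]⟪V,e⟫ = −∫ψ⟪GΩ,e⟫` (the weakly
  divergence-free `Ω ∈ L²_loc` against the `W^{1,2}_c` function `ψ⟪V,e⟫`) — files `…WeakVorticityTools/Pairings/Lamb`.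
  The binder `HasTransportDivergence` (`div W = 3γ`) is part of the stub's signature and not used.
[folklore; MajdaBertozziCUP2002 §2.1 eq. (2.5) (vorticity equation); Serrin1963 §4; Evans2010 §5.2–5.3]

WHAT THIS IS NOT: not NS, not E, not E2/X1a/X1b — the shared first-order brick of the Eulerian weak lines; 19832 is OPEN.
-/

noncomputable section

-- flat `Theorems/<Route><Decl>…` files of one crux share the namespace of the crux (tree convention)
set_option linter.dupNamespace false

open MeasureTheory Set Filter Topology Metric Function TopologicalSpace
open scoped ENNReal NNReal RealInnerProductSpace ContDiff

namespace Summit.NavierStokesRegularity.NavierStokesRegularity.Theorems.PowerGaugeEulerLiouville.WeakEulerian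

open Literature.Analysis Literature.Analysis.FunctionSpaces Literature.Analysis.FluidPDE
open Summit.NavierStokesRegularity.NavierStokesRegularity.Theorems.PowerGaugeEulerLiouville

section Profile

variable {γ : ℝ} {V : EuclideanSpace ℝ (Fin 3) → EuclideanSpace ℝ (Fin 3)} {P : EuclideanSpace ℝ (Fin 3) → ℝ}
  {G : EuclideanSpace ℝ (Fin 3) → EuclideanSpace ℝ (Fin 3) →L[ℝ] EuclideanSpace ℝ (Fin 3)}

/-- **THE WEAK VORTICITY EQUATION FROM THE WEAK PROFILE EQUATION** (profile level, any `γ`).  Let `V ∈ L⁶_loc` be weakly divergence free with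
whole-space weak gradient `G ∈ L²_loc`, and let `(V, P)` solve the weak profile equation
`∫ (⟪V, DΨ V⟫ + P div Ψ + γ⟪V, DΨ x x⟫ + (4γ − 1)⟪V, Ψ⟫) = 0` for every vector test field `Ψ`.  Then `Ω = curlCLM ∘ G` solves
`∫ ⟪Ω, e⟫ Dψ[γ(x − 0) + V x] = ∫ ψ ⟪(1 − 3γ)Ω − GΩ, e⟫` for every scalar test `ψ` and every `e`. [folklore; MajdaBertozziCUP2002 §2.1 (2.5)] -/
theorem solvesWeakVorticity_of_profileEquation (hVm : AEStronglyMeasurable V volume)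
    (hVG : HasWeakFDerivOn (⊤ : Opens (EuclideanSpace ℝ (Fin 3))) volume V G)
    (hV6 : ∀ r : ℝ, MemLp V 6 (volume.restrict (ball (0 : EuclideanSpace ℝ (Fin 3)) r)))
    (hG2 : ∀ r : ℝ, MemLp G 2 (volume.restrict (ball (0 : EuclideanSpace ℝ (Fin 3)) r)))
    (hdiv : IsWeaklyDivFree V)
    (hprof : ∀ Ψ : EuclideanSpace ℝ (Fin 3) → EuclideanSpace ℝ (Fin 3),
      IsTestFunctionOn (⊤ : Opens (EuclideanSpace ℝ (Fin 3))) Ψ →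
        ∫ x, (⟪V x, fderiv ℝ Ψ x (V x)⟫ + P x * VectorCalculus.divergence Ψ x +
          γ * ⟪V x, fderiv ℝ Ψ x x⟫ + (4 * γ - 1) * ⟪V x, Ψ x⟫) = 0)
    {ψ : EuclideanSpace ℝ (Fin 3) → ℝ} (hψ : IsTestFunctionOn (⊤ : Opens (EuclideanSpace ℝ (Fin 3))) ψ) (e : EuclideanSpace ℝ (Fin 3)) :
    ∫ y, ⟪curlCLM (G y), e⟫ * fderiv ℝ ψ y (γ • (y - 0) + V y) =
      ∫ y, ψ y * ⟪(1 - 3 * γ) • curlCLM (G y) - G y (curlCLM (G y)), e⟫ := by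
  -- ### data
  have hVl : LocallyIntegrable V volume := locallyIntegrableOn_univ.1 (by
    simpa only [Opens.coe_top] using hVG.locallyIntegrableOn)
  have hV2 : ∀ r : ℝ, MemLp V 2 (volume.restrict (ball (0 : EuclideanSpace ℝ (Fin 3)) r)) := fun r => by
    haveI : IsFiniteMeasure ((volume : Measure (EuclideanSpace ℝ (Fin 3))).restrict (ball (0 : EuclideanSpace ℝ (Fin 3)) r)) :=
      isFiniteMeasure_restrict.2 measure_ball_lt_top.ne
    exact (hV6 r).mono_exponent (by norm_num)
  have hV2loc : LocallyIntegrable (fun y => ‖V y‖ ^ 2) volume := by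
    refine (locallyIntegrable_iff).2 fun K hK => ?_
    obtain ⟨r, hr⟩ := hK.isBounded.subset_ball (0 : EuclideanSpace ℝ (Fin 3))
    exact IntegrableOn.mono_set (show IntegrableOn (fun y => ‖V y‖ ^ 2) (ball 0 r) volume from
      (hV2 r).integrable_norm_pow two_ne_zero) hr
  set Ω : EuclideanSpace ℝ (Fin 3) → EuclideanSpace ℝ (Fin 3) := fun x => curlCLM (G x) with hΩ
  set Ψ : EuclideanSpace ℝ (Fin 3) → EuclideanSpace ℝ (Fin 3) := curl (fun y => ψ y • e) with hΨ
  have hΨt : IsTestFunctionOn (⊤ : Opens (EuclideanSpace ℝ (Fin 3))) Ψ := isTestFunctionOn_curl_smul_const hψ e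
  have hΨc : Continuous Ψ := hΨt.contDiff.continuous
  have hDΨc : Continuous (fderiv ℝ Ψ) := hΨt.contDiff.continuous_fderiv (by simp)
  obtain ⟨CΨ', hCΨ'⟩ := hDΨc.bounded_above_of_compact_support (hΨt.hasCompactSupport.fderiv (𝕜 := ℝ))
  -- the radial-derivative test `ψ₁ − ψ`
  set ψ₁ : EuclideanSpace ℝ (Fin 3) → ℝ := fun x => fderiv ℝ ψ x x with hψ₁
  have hψ₁t : IsTestFunctionOn (⊤ : Opens (EuclideanSpace ℝ (Fin 3))) ψ₁ := isTestFunctionOn_fderiv_apply_self hψ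
  have hψ₁ψ : IsTestFunctionOn (⊤ : Opens (EuclideanSpace ℝ (Fin 3))) (fun x => ψ₁ x - ψ x) :=
    ⟨hψ₁t.contDiff.sub hψ.contDiff, hψ₁t.hasCompactSupport.sub hψ.hasCompactSupport, by simp⟩
  -- ### integrability of the profile-equation terms
  have hIA : Integrable (fun x => ⟪V x, fderiv ℝ Ψ x (V x)⟫) volume := by
    refine Integrable.mono' (hV2loc.integrable_smul_left_of_hasCompactSupport hDΨc.norm (hΨt.hasCompactSupport.fderiv (𝕜 := ℝ)).norm)
      (hVm.inner (Continuous.comp_aestronglyMeasurable₂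
        (g := fun (L : EuclideanSpace ℝ (Fin 3) →L[ℝ] EuclideanSpace ℝ (Fin 3)) (v : EuclideanSpace ℝ (Fin 3)) => L v)
        (isBoundedBilinearMap_apply (𝕜 := ℝ) (E := EuclideanSpace ℝ (Fin 3)) (F := EuclideanSpace ℝ (Fin 3))).continuous
        hDΨc.aestronglyMeasurable hVm))
      (Eventually.of_forall fun x => ?_)
    rw [smul_eq_mul]
    calc ‖⟪V x, fderiv ℝ Ψ x (V x)⟫‖ ≤ ‖V x‖ * ‖fderiv ℝ Ψ x (V x)‖ := norm_inner_le_norm _ _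
      _ ≤ ‖V x‖ * (‖fderiv ℝ Ψ x‖ * ‖V x‖) := mul_le_mul_of_nonneg_left ((fderiv ℝ Ψ x).le_opNorm _) (norm_nonneg _)
      _ = ‖fderiv ℝ Ψ x‖ * ‖V x‖ ^ 2 := by ring
  have hIC : Integrable (fun x => ⟪V x, fderiv ℝ Ψ x x⟫) volume :=
    Literature.Analysis.FluidPDE.integrable_inner_of_locallyIntegrable_of_hasCompactSupport hVl (hDΨc.clm_apply continuous_id)
      ((hΨt.hasCompactSupport.fderiv (𝕜 := ℝ)).mono fun x hx => by
        rw [mem_support] at hx ⊢; intro h; exact hx (by rw [h, _root_.zero_apply]))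
  have hID : Integrable (fun x => ⟪V x, Ψ x⟫) volume :=
    Literature.Analysis.FluidPDE.integrable_inner_of_locallyIntegrable_of_hasCompactSupport hVl hΨc hΨt.hasCompactSupport
  -- ### the profile equation tested with `Ψ`: `T_A + γ T_C + (4γ−1) T_D = 0`
  have hM : (∫ x, ⟪V x, fderiv ℝ Ψ x (V x)⟫) + γ * (∫ x, ⟪V x, fderiv ℝ Ψ x x⟫) + (4 * γ - 1) * ∫ x, ⟪V x, Ψ x⟫ = 0 := by
    have h := hprof Ψ hΨt
    have hP : ∀ x, P x * VectorCalculus.divergence Ψ x = 0 := fun x => by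
      rw [hΨ, divergence_curl_smul_const hψ.contDiff e x, mul_zero]
    simp_rw [hP, add_zero] at h
    have i1 : Integrable (fun x => γ * ⟪V x, fderiv ℝ Ψ x x⟫) volume := hIC.const_mul γ
    have i2 : Integrable (fun x => (4 * γ - 1) * ⟪V x, Ψ x⟫) volume := hID.const_mul _
    have i12 : Integrable (fun x => ⟪V x, fderiv ℝ Ψ x (V x)⟫ + γ * ⟪V x, fderiv ℝ Ψ x x⟫) volume := hIA.add i1
    rw [integral_add i12 i2, integral_add hIA i1, integral_const_mul, integral_const_mul] at h
    exact h
  -- ### `T_D = ∫ ψ⟪Ω, e⟫`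
  have hTD : ∫ x, ⟪V x, Ψ x⟫ = ∫ x, ψ x * ⟪Ω x, e⟫ := integral_inner_curl_smul_const hVG hψ e
  -- ### `T_C = ∫ (ψ₁ − ψ)⟪Ω, e⟫`
  have hTC : ∫ x, ⟪V x, fderiv ℝ Ψ x x⟫ = (∫ x, ψ₁ x * ⟪Ω x, e⟫) - ∫ x, ψ x * ⟪Ω x, e⟫ := by
    have h1 : ∫ x, ⟪V x, fderiv ℝ Ψ x x⟫ = ∫ x, ⟪V x, curl (fun y => (ψ₁ y - ψ y) • e) x⟫ := by
      refine integral_congr_ae (Eventually.of_forall fun x => ?_)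
      dsimp only
      rw [hΨ, fderiv_curl_smul_const_apply_self hψ.contDiff e x]
    rw [h1, integral_inner_curl_smul_const hVG hψ₁ψ e]
    simp_rw [sub_mul]
    exact integral_sub (integrable_mul_inner_curlCLM hVG hG2 hψ₁t.contDiff.continuous hψ₁t.hasCompactSupport e)
      (integrable_mul_inner_curlCLM hVG hG2 hψ.contDiff.continuous hψ.hasCompactSupport e)
  -- ### `T_A = ∫ψ⟪GΩ,e⟫ + ∫⟪Ω,e⟫Dψ[V]`
  have hTA : ∫ x, ⟪V x, fderiv ℝ Ψ x (V x)⟫ = (∫ x, ψ x * ⟪G x (Ω x), e⟫) + ∫ x, ⟪Ω x, e⟫ * fderiv ℝ ψ x (V x) := by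
    rw [WeakPressure.integral_inner_fderiv_apply_self hVm hV6 hVG hG2 hdiv hΨt]
    -- Lamb–Lagrange pointwise
    have hpt : ∀ x, ⟪G x (V x), Ψ x⟫ =
        ⟪G x (Ψ x), V x⟫ + fderiv ℝ ψ x (Ω x) * ⟪V x, e⟫ - ⟪Ω x, e⟫ * fderiv ℝ ψ x (V x) := fun x => by
      rw [hΨ, curl_smul_const hψ.contDiff e x]
      exact inner_apply_curlCLM_smulRight (G x) (fderiv ℝ ψ x) (V x) e
    have i1 : Integrable (fun x => ⟪G x (Ψ x), V x⟫) volume := integrable_inner_apply_testField hVG hV2 hG2 hΨc hΨt.hasCompactSupport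
    have i2 : Integrable (fun x => fderiv ℝ ψ x (Ω x) * ⟪V x, e⟫) volume := integrable_fderiv_apply_curlCLM_mul_inner hVG hV2 hG2 hψ e
    have i3 : Integrable (fun x => ⟪Ω x, e⟫ * fderiv ℝ ψ x (V x)) volume := integrable_inner_curlCLM_mul_fderiv_apply hVG hV2 hG2 hψ e
    have i12 : Integrable (fun x => ⟪G x (Ψ x), V x⟫ + fderiv ℝ ψ x (Ω x) * ⟪V x, e⟫) volume := i1.add i2
    simp_rw [hpt]
    rw [integral_sub i12 i3, integral_add i1 i2, integral_inner_apply_curl_smul_const_eq_zero hVG hV2 hG2 hψ e,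
      integral_fderiv_apply_curlCLM_mul_inner hVG hV2 hG2 hψ e]
    ring
  -- ### the right-hand side
  have hR : ∫ y, ψ y * ⟪(1 - 3 * γ) • Ω y - G y (Ω y), e⟫ = (1 - 3 * γ) * (∫ y, ψ y * ⟪Ω y, e⟫) - ∫ y, ψ y * ⟪G y (Ω y), e⟫ := by
    rw [← integral_const_mul, ← integral_sub ((integrable_mul_inner_curlCLM hVG hG2 hψ.contDiff.continuous hψ.hasCompactSupport e).const_mul _)
      (integrable_mul_inner_apply_curlCLM hVG hG2 hψ e)]
    refine integral_congr_ae (Eventually.of_forall fun y => ?_)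
    simp only [inner_sub_left, real_inner_smul_left]
    ring
  -- ### the left-hand side
  have hL : ∫ y, ⟪Ω y, e⟫ * fderiv ℝ ψ y (γ • (y - 0) + V y) = γ * (∫ y, ψ₁ y * ⟪Ω y, e⟫) + ∫ y, ⟪Ω y, e⟫ * fderiv ℝ ψ y (V y) := by
    rw [← integral_const_mul, ← integral_add ((integrable_mul_inner_curlCLM hVG hG2 hψ₁t.contDiff.continuous hψ₁t.hasCompactSupport e).const_mul _)
      (integrable_inner_curlCLM_mul_fderiv_apply hVG hV2 hG2 hψ e)]
    refine integral_congr_ae (Eventually.of_forall fun y => ?_)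
    simp only [hψ₁, sub_zero, map_add, map_smul, smul_eq_mul]
    ring
  rw [hL, hR]
  rw [hTA, hTC, hTD] at hM
  linarith

end Profile

/-! ### The member-level theorem (the lines' stub E1 / X0, δ-unfolded) -/

section Member

/-- **`stub_weakVorticityEquation` (E1 of `Lines/weak_eulerian.lean` = X0 of `Lines/weak_axisym.lean`)**, with `InClass`, `IsExactlySelfSimilar`,
`IsProfileGradient`, `HasTransportDivergence`, `SolvesWeakVorticity`, `transportW` δ-unfolded (both lines fill it by
`intro ρ hρ hρh u p H c V P G hcl hss hG hdiv; exact WeakEulerian.weakVorticityEquation hρ hρh hcl hss hG hdiv`):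
the profile of a weak exactly self-similar class member (any `ρ ∈ (0,½]`) with DiPerna–Lions data `G` solves the weak vorticity equation
`∫ ⟪Ω, e⟫ Dψ[W] = ∫ ψ ⟪(1 − 3γ)Ω − GΩ, e⟫`, `Ω = curlCLM ∘ G`, `W = γy + V`.  The class supplies measurability, `div V = 0` and the weak profile equation
(`Past.profileData_of_past`); then `solvesWeakVorticity_of_profileEquation`.  The divergence clause `div W = 3γ` is part of the stub's binder and not used.
[folklore; MajdaBertozziCUP2002 §2.1 eq. (2.5)] -/
theorem weakVorticityEquation {ρ : ℝ} (hρ : 0 < ρ) (hρh : ρ ≤ 1 / 2)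
    {u : ℝ → EuclideanSpace ℝ (Fin 3) → EuclideanSpace ℝ (Fin 3)} {p : ℝ → EuclideanSpace ℝ (Fin 3) → ℝ}
    {H : ℝ → EuclideanSpace ℝ (Fin 3) → EuclideanSpace ℝ (Fin 3) →L[ℝ] EuclideanSpace ℝ (Fin 3)} {c : ℝ≥0}
    {V : EuclideanSpace ℝ (Fin 3) → EuclideanSpace ℝ (Fin 3)} {P : EuclideanSpace ℝ (Fin 3) → ℝ}
    {G : EuclideanSpace ℝ (Fin 3) → EuclideanSpace ℝ (Fin 3) →L[ℝ] EuclideanSpace ℝ (Fin 3)}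
    (hcls : IsSuitableWeakSolutionOn (slab (EuclideanSpace ℝ (Fin 3)) (Set.Iio 0) isOpen_Iio) 0 0 u p ∧
      HasWeakSpatialGradientOn (slab (EuclideanSpace ℝ (Fin 3)) (Set.Iio 0) isOpen_Iio) u H ∧
      (∀ a : ℝ, 0 < a →
        ENNReal.ofReal (a ^ (2 * ρ)) * cknA a (0 : ℝ × EuclideanSpace ℝ (Fin 3)) u +
            ENNReal.ofReal (a ^ ρ) * cknE a (0 : ℝ × EuclideanSpace ℝ (Fin 3)) H +
          ENNReal.ofReal (a ^ (2 * ρ)) * cknD a (0 : ℝ × EuclideanSpace ℝ (Fin 3)) p ≤ (c : ℝ≥0∞)))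
    (hss : (∀ τ : ℝ, τ < 0 → u τ = selfSimilarCollapse (1 / (2 + ρ)) 0 V τ) ∧
      (∀ τ : ℝ, τ < 0 → p τ = selfSimilarCollapsePressure (1 / (2 + ρ)) 0 P τ))
    (hPG : HasWeakFDerivOn (⊤ : Opens (EuclideanSpace ℝ (Fin 3))) volume V G ∧
      (∀ r : ℝ, MemLp G 2 (volume.restrict (ball (0 : EuclideanSpace ℝ (Fin 3)) r))) ∧
      (∀ r : ℝ, MemLp V 6 (volume.restrict (ball (0 : EuclideanSpace ℝ (Fin 3)) r))) ∧
      HasWeakFDerivOn (⊤ : Opens (EuclideanSpace ℝ (Fin 3))) volume (selfSimilarTransport (1 / (2 + ρ)) 0 V)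
        (fun x => (1 / (2 + ρ)) • ContinuousLinearMap.id ℝ (EuclideanSpace ℝ (Fin 3)) + G x))
    (_hdiv : ∀ φ : EuclideanSpace ℝ (Fin 3) → ℝ, IsTestFunctionOn (⊤ : Opens (EuclideanSpace ℝ (Fin 3))) φ →
      ∫ y, ⟪selfSimilarTransport (1 / (2 + ρ)) 0 V y, gradient φ y⟫ = -(3 * (1 / (2 + ρ))) * ∫ y, φ y) :
    ∀ ψ : EuclideanSpace ℝ (Fin 3) → ℝ, IsTestFunctionOn (⊤ : Opens (EuclideanSpace ℝ (Fin 3))) ψ → ∀ e : EuclideanSpace ℝ (Fin 3),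
      ∫ y, ⟪curlCLM (G y), e⟫ * fderiv ℝ ψ y (selfSimilarTransport (1 / (2 + ρ)) 0 V y) =
        ∫ y, ψ y * ⟪(1 - 3 * (1 / (2 + ρ))) • curlCLM (G y) - G y (curlCLM (G y)), e⟫ := by
  intro ψ hψ e
  obtain ⟨hsw, hH, hgauge⟩ := hcls
  obtain ⟨hu, hp⟩ := hss
  obtain ⟨hVG, hG2, hV6, -⟩ := hPG
  -- ### class data (as in `WeakEulerian.supportDensityLaw`)
  have hA : ∀ a : ℝ, 0 < a → ENNReal.ofReal (a ^ (2 * ρ)) *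
      cknA a (0 : ℝ × EuclideanSpace ℝ (Fin 3)) u ≤ (c : ℝ≥0∞) :=
    fun a ha => le_trans (le_trans le_self_add le_self_add) (hgauge a ha)
  have hE : ∀ a : ℝ, 0 < a → ENNReal.ofReal (a ^ ρ) *
      cknE a (0 : ℝ × EuclideanSpace ℝ (Fin 3)) H ≤ (c : ℝ≥0∞) :=
    fun a ha => le_trans (le_trans le_add_self le_self_add) (hgauge a ha)
  have hD : ∀ a : ℝ, 0 < a → ENNReal.ofReal (a ^ (2 * ρ)) *
      cknD a (0 : ℝ × EuclideanSpace ℝ (Fin 3)) p ≤ (c : ℝ≥0∞) :=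
    fun a ha => le_trans le_add_self (hgauge a ha)
  have hu' : ∀ τ : ℝ, τ < 0 → u τ = fun x => selfSimilarCollapse (1 / (2 + ρ)) 0 V τ (x - 0) :=
    fun τ hτ => by rw [hu τ hτ]; funext x; rw [sub_zero]
  have hp' : ∀ τ : ℝ, τ < 0 → p τ = fun x => selfSimilarCollapsePressure (1 / (2 + ρ)) 0 P τ (x - 0) :=
    fun τ hτ => by rw [hp τ hτ]; funext x; rw [sub_zero]
  obtain ⟨G', hVm, -, -, -, -, -, -, -, -, -, -, hdivV, hprof, -, -⟩ :=
    Past.profileData_of_past hρ hρh le_rfl le_rfl 0 hsw.distributional hH hA hE hD hu' hp'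
  have h := solvesWeakVorticity_of_profileEquation (γ := 1 / (2 + ρ)) hVm hVG hV6 hG2 hdivV hprof hψ e
  simpa only [selfSimilarTransport_apply] using h

end Member

end Summit.NavierStokesRegularity.NavierStokesRegularity.Theorems.PowerGaugeEulerLiouville.WeakEulerian

end
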